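import Literature.NumberTheory.EllipticCurves.Kobayashi2003.EtaBranchLFunctionUniqueProofs
import Mathlib.FieldTheory.Galois.Infinite
import Mathlib.Topology.Algebra.Module.FiniteDimension
import Mathlib.Analysis.Normed.Module.FiniteDimension
import HarnessLib

/-!
# Descent of the constant of proportionality of two Iwasawa functions from `ℂ_p` to `ℚ_p`
# (Weierstrass zeros + Galois descent inside `ℚ̄_p`) — kernel tool, THEOREMS ONLY

Topic `NumberTheory/EllipticCurves`; namespace `Literature.NumberTheory.EllipticCurves`. THEOREMS ONLY (net debt 0): no
`def … : Prop`, no named fact, no instance, no notation, no `sorry`. Cell `bsd-cm`, seat `bsd-cm-k-ty1` g39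
(literature-prover; director-bsd (970)(a), pen D1202/D1203): kernel tool for the 2c-T1 composition of crux
stmt-BirchSwinnertonDyer-19223 (`CccOneLawOnTypeIstarZero`), where Kobayashi's interpolation law of the even Coleman map
AS A MAP (`Kobayashi2003.ColPlusInterpolation`, form (β): ONE unpinned scalar `λ ∈ ℂ_p`) is compared with the pinned
plus-function law of `Kobayashi2003.IsQuadraticBranchPlusLFunction`. Nothing about BSD is asserted or advanced here.

## What

Let `g, h ∈ Λ = ℤ_p⟦T⟧`, `g ≠ 0`, and suppose that for ONE constant `C ∈ ℂ_p` and EVERY even `n ≥ 2` and every Dirichlet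
character `ψ` mod `p^{n+1}` of order `2pⁿ` with values in `ℂ_p` (`ζ = ψ(1+p)` runs over ALL primitive `pⁿ`-th roots of
unity of `ℂ_p`, `Kobayashi2003.exists_dirichletCharacter_orderOf_two_mul_prime_pow`) the values satisfy
`g(ζ − 1) = C · h(ζ − 1)`. THEN `C ∈ ℚ_pˣ` and `p^a · g = v · p^b · h` in `Λ` for some `a b : ℕ`, `v ∈ ℤ_pˣ`
(`IwasawaAlgebra.exists_pow_smul_eq_of_values_proportional`).

WHY A PROOF IS NEEDED («the ratio of two Λ-integral functions agreeing up to a constant is automatic» is true but not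
formal): the constant is a priori an element of `ℂ_p`, and `g − C·h` is not an element of `Λ ⊗ ℚ_p` to which the
uniqueness principle (`MemIwasawaRat.finite_setOf_hasSum_zero`, Weierstrass preparation) applies.

## Proof (§3)

(1) `g ≠ 0` has finitely many zeros in the open unit disc (`MemIwasawaRat.finite_setOf_hasSum_zero`), the points `ζ − 1`
(`ζ` of order `pⁿ`, `n` even) are infinitely many, so `g(ζ₁ − 1) ≠ 0` for some `ζ₁` of order `p^{n₁}` taken INSIDE the
algebraic closure `ℚ̄_p = PadicAlgCl p` (its image in `ℂ_p = \widehat{ℚ̄_p}`); hence `C ≠ 0` and `h(ζ₁ − 1) ≠ 0`.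
(2) ALGEBRAICITY (§1): the partial sums of `g(ζ₁ − 1)` lie in the image of the finite-dimensional `ℚ_p`-subalgebra
`ℚ_p[ζ₁] ⊂ ℚ̄_p`, which is CLOSED in `ℂ_p` (`Submodule.closed_of_finiteDimensional`, `ℚ_p` complete), so
`g(ζ₁ − 1) = a_g`, `h(ζ₁ − 1) = a_h` with `a_g, a_h ∈ ℚ_p[ζ₁]`, and `C = a_g / a_h ∈ ℚ̄_p`.
(3) GALOIS TRANSPORT (§2): for `σ ∈ Aut(ℚ̄_p/ℚ_p)` the `ℚ_p`-linear map `x ↦ σ(x)` on `ℚ_p[ζ₁]` is CONTINUOUS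
(finite dimension, `LinearMap.continuous_of_finiteDimensional`) and maps the partial sums at `ζ₁` to those at `σζ₁`,
so `g(σζ₁ − 1) = σ(a_g)`, `h(σζ₁ − 1) = σ(a_h)`; `σζ₁` is again of order `p^{n₁}`, so the hypothesis at `σζ₁` gives
`σ(a_g) = C·σ(a_h)`, i.e. `σ(C) = C`.
(4) `ℚ̄_p/ℚ_p` is Galois (`IsAlgClosure.isGalois`), so `C ∈ ℚ_p` (`InfiniteGalois.mem_range_algebraMap_iff_fixed`),
`C = c ≠ 0`; write `p^m c = v p^b ∈ ℤ_p` (`PadicInt.unitCoeff`).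
(5) `D := p^m g − (p^m c) h ∈ Λ` vanishes at every `ζ − 1` as above, so `D = 0` (step (1) for `D`).

No continuity of Galois automorphisms on `ℂ_p` and no Ax–Sen–Tate is used: everything happens on a finite-dimensional
`ℚ_p`-subspace.

References: L. C. Washington, *Introduction to Cyclotomic Fields*, GTM 83, Thm. 7.3 and §7.2 (Weierstrass preparation,
zeros of Iwasawa functions) [Washington1997]; S. Lang, *Cyclotomic Fields I and II*, Ch. 5 §2 Thm. 2.2 [Lang1990];
B. Mazur, J. Tate, J. Teitelbaum, Invent. Math. 84 (1986) §I.12–I.14 (uniqueness by interpolation) [MazurTateTeitelbaum1986Invent];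
S. Kobayashi, Invent. Math. 152 (2003) §3 (3.4) (the characters `ψ` of order `2pⁿ`) [Kobayashi2003]. Tree:
`PAdicPowerSeriesZeros.lean`, `Kobayashi2003/EtaBranchLFunctionUniqueProofs.lean` (the template `exists_units_smul_eq`).
-/

noncomputable section

open Filter Topology

namespace Literature.NumberTheory.EllipticCurves

variable {p : ℕ} [hp : Fact p.Prime]

/-! ## §1 Values of Iwasawa functions at algebraic points of the open disc are algebraic -/

section Algebraic

/-- `ℚ_p → ℂ_p` factors through `ℚ̄_p`. [folklore] -/
private theorem algebraMap_padicComplex_eq_comp :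
    algebraMap ℚ_[p] ℂ_[p] = (algebraMap (PadicAlgCl p) ℂ_[p]).comp (algebraMap ℚ_[p] (PadicAlgCl p)) :=
  IsScalarTower.algebraMap_eq ℚ_[p] (PadicAlgCl p) ℂ_[p]

/-- Partial sums of `Σ ι(G_k)·z^k` at an algebraic `z ∈ S ⊂ ℚ̄_p` lie in the image of the subalgebra `S`. [folklore] -/
private theorem sum_range_mem_map (S : Subalgebra ℚ_[p] (PadicAlgCl p)) (G : IwasawaAlgebra p)
    {z' : PadicAlgCl p} (hz' : z' ∈ S) (K : ℕ) :
    ∑ k ∈ Finset.range K, ((algebraMap ℚ_[p] ℂ_[p]).comp (algebraMap ℤ_[p] ℚ_[p])) (PowerSeries.coeff k G) *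
        (algebraMap (PadicAlgCl p) ℂ_[p] z') ^ k ∈
      (Subalgebra.toSubmodule S).map (IsScalarTower.toAlgHom ℚ_[p] (PadicAlgCl p) ℂ_[p]).toLinearMap := by
  refine ⟨∑ k ∈ Finset.range K, algebraMap ℚ_[p] (PadicAlgCl p) ((PowerSeries.coeff k G : ℤ_[p]) : ℚ_[p]) * z' ^ k,
    ?_, ?_⟩
  · refine Subalgebra.sum_mem S fun k _ => Subalgebra.mul_mem S (Subalgebra.algebraMap_mem S _)
      (Subalgebra.pow_mem S hz' k)
  · rw [AlgHom.toLinearMap_apply, map_sum]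
    refine Finset.sum_congr rfl fun k _ => ?_
    rw [map_mul, map_pow, RingHom.comp_apply, PadicInt.algebraMap_apply, algebraMap_padicComplex_eq_comp,
      RingHom.comp_apply]
    rfl

/-- **The value of an Iwasawa function at an algebraic point of the open unit disc is algebraic**: if `S ⊂ ℚ̄_p` is a
`ℚ_p`-subalgebra which is finite-dimensional, `z ∈ S` with `|z| < 1`, and `G ∈ Λ`, then `Σ_k G_k z^k = a` for some
`a ∈ S` (the image of `S` in `ℂ_p` is a finite-dimensional, hence closed, `ℚ_p`-subspace containing all partial sums).
[cite: Washington1997, §7.2] -/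
theorem exists_mem_hasSum_of_mem_subalgebra (S : Subalgebra ℚ_[p] (PadicAlgCl p))
    [FiniteDimensional ℚ_[p] (Subalgebra.toSubmodule S)] (G : IwasawaAlgebra p)
    {z' : PadicAlgCl p} (hz' : z' ∈ S) (hz : ‖algebraMap (PadicAlgCl p) ℂ_[p] z'‖ < 1) :
    ∃ a ∈ S, HasSum (fun k ↦ ((algebraMap ℚ_[p] ℂ_[p]).comp (algebraMap ℤ_[p] ℚ_[p])) (PowerSeries.coeff k G) *
        (algebraMap (PadicAlgCl p) ℂ_[p] z') ^ k) (algebraMap (PadicAlgCl p) ℂ_[p] a) := by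
  set V : Submodule ℚ_[p] ℂ_[p] :=
    (Subalgebra.toSubmodule S).map (IsScalarTower.toAlgHom ℚ_[p] (PadicAlgCl p) ℂ_[p]).toLinearMap with hV
  have hVc : IsClosed (V : Set ℂ_[p]) := V.closed_of_finiteDimensional
  have hsum := summable_map_coeff_mul_pow ((algebraMap ℚ_[p] ℂ_[p]).comp (algebraMap ℤ_[p] ℚ_[p]))
    (norm_algebraMap_coeff_le_one G) hz
  have hlim := hsum.hasSum.tendsto_sum_nat
  have hmem : (∑' k, ((algebraMap ℚ_[p] ℂ_[p]).comp (algebraMap ℤ_[p] ℚ_[p])) (PowerSeries.coeff k G) *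
      (algebraMap (PadicAlgCl p) ℂ_[p] z') ^ k) ∈ V :=
    hVc.mem_of_tendsto hlim (Filter.Eventually.of_forall fun K => sum_range_mem_map S G hz' K)
  obtain ⟨a, haS, ha⟩ := hmem
  exact ⟨a, haS, by rw [AlgHom.toLinearMap_apply, IsScalarTower.toAlgHom_apply] at ha; rw [ha]; exact hsum.hasSum⟩

end Algebraic

/-! ## §2 Galois transport of values along `Aut(ℚ̄_p/ℚ_p)` on a finite-dimensional piece -/

section Transport

/-- **Galois transport of a value.** Let `S ⊂ ℚ̄_p` be a finite-dimensional `ℚ_p`-subalgebra, `z, a ∈ S` with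
`Σ_k G_k z^k = a` in `ℂ_p` (`|z| < 1`), and `σ ∈ Aut(ℚ̄_p/ℚ_p)` with `|σ z| < 1`. Then `Σ_k G_k (σz)^k = σ(a)`: the
`ℚ_p`-linear map `x ↦ σ(x)` on the image of `S` is continuous (finite dimension over the complete field `ℚ_p`), and it
maps the partial sums at `z` to the partial sums at `σ z`. [cite: Washington1997, §7.2] -/
theorem hasSum_map_of_hasSum_of_mem_subalgebra (S : Subalgebra ℚ_[p] (PadicAlgCl p))
    [FiniteDimensional ℚ_[p] (Subalgebra.toSubmodule S)] (G : IwasawaAlgebra p)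
    (σ : PadicAlgCl p ≃ₐ[ℚ_[p]] PadicAlgCl p) {z' a : PadicAlgCl p} (hz' : z' ∈ S) (haS : a ∈ S)
    (ha : HasSum (fun k ↦ ((algebraMap ℚ_[p] ℂ_[p]).comp (algebraMap ℤ_[p] ℚ_[p])) (PowerSeries.coeff k G) *
        (algebraMap (PadicAlgCl p) ℂ_[p] z') ^ k) (algebraMap (PadicAlgCl p) ℂ_[p] a))
    (hσz : ‖algebraMap (PadicAlgCl p) ℂ_[p] (σ z')‖ < 1) :
    HasSum (fun k ↦ ((algebraMap ℚ_[p] ℂ_[p]).comp (algebraMap ℤ_[p] ℚ_[p])) (PowerSeries.coeff k G) *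
        (algebraMap (PadicAlgCl p) ℂ_[p] (σ z')) ^ k) (algebraMap (PadicAlgCl p) ℂ_[p] (σ a)) := by
  set ιA : PadicAlgCl p →ₐ[ℚ_[p]] ℂ_[p] := IsScalarTower.toAlgHom ℚ_[p] (PadicAlgCl p) ℂ_[p] with hιA
  have hιA_apply : ∀ x, ιA x = algebraMap (PadicAlgCl p) ℂ_[p] x := fun x => rfl
  have hinj : Function.Injective ιA.toLinearMap := fun x y hxy => (algebraMap (PadicAlgCl p) ℂ_[p]).injective hxy
  set V : Submodule ℚ_[p] ℂ_[p] := (Subalgebra.toSubmodule S).map ιA.toLinearMap with hV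
  -- the transport map `T : V → ℂ_p`, `ιA x ↦ ιA (σ x)`
  set e : Subalgebra.toSubmodule S ≃ₗ[ℚ_[p]] V := Submodule.equivMapOfInjective ιA.toLinearMap hinj _ with he
  set T : V →ₗ[ℚ_[p]] ℂ_[p] :=
    (ιA.toLinearMap ∘ₗ (σ : PadicAlgCl p ≃ₐ[ℚ_[p]] PadicAlgCl p).toLinearMap ∘ₗ
      (Subalgebra.toSubmodule S).subtype) ∘ₗ e.symm.toLinearMap with hT
  have hTcont : Continuous T := T.continuous_of_finiteDimensional
  have hT_apply : ∀ (x : PadicAlgCl p) (hx : x ∈ S),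
      T ⟨ιA x, ⟨x, hx, rfl⟩⟩ = ιA (σ x) := by
    intro x hx
    have hex : e ⟨x, hx⟩ = ⟨ιA x, ⟨x, hx, rfl⟩⟩ := by
      apply Subtype.ext
      rw [Submodule.coe_equivMapOfInjective_apply]
      rfl
    rw [hT, LinearMap.comp_apply, LinearEquiv.coe_toLinearMap, ← hex, LinearEquiv.symm_apply_apply]
    rfl
  -- partial sums as elements of `V`
  set u : ℕ → V := fun K => ⟨∑ k ∈ Finset.range K, ((algebraMap ℚ_[p] ℂ_[p]).comp (algebraMap ℤ_[p] ℚ_[p]))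
      (PowerSeries.coeff k G) * (algebraMap (PadicAlgCl p) ℂ_[p] z') ^ k, sum_range_mem_map S G hz' K⟩ with hu
  have hlimV : Tendsto u atTop (𝓝 ⟨algebraMap (PadicAlgCl p) ℂ_[p] a, ⟨a, haS, rfl⟩⟩) := by
    rw [tendsto_subtype_rng]
    exact ha.tendsto_sum_nat
  have hlimT := (hTcont.tendsto _).comp hlimV
  -- identify `T (u K)` with the partial sums at `σ z'` and `T (ιA a)` with `ιA (σ a)`
  have hTa : T ⟨algebraMap (PadicAlgCl p) ℂ_[p] a, ⟨a, haS, rfl⟩⟩ = algebraMap (PadicAlgCl p) ℂ_[p] (σ a) :=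
    hT_apply a haS
  have hTu : ∀ K, T (u K) = ∑ k ∈ Finset.range K, ((algebraMap ℚ_[p] ℂ_[p]).comp (algebraMap ℤ_[p] ℚ_[p]))
      (PowerSeries.coeff k G) * (algebraMap (PadicAlgCl p) ℂ_[p] (σ z')) ^ k := by
    intro K
    have hmem : (∑ k ∈ Finset.range K, algebraMap ℚ_[p] (PadicAlgCl p) ((PowerSeries.coeff k G : ℤ_[p]) : ℚ_[p]) *
        z' ^ k) ∈ S :=
      Subalgebra.sum_mem S fun k _ => Subalgebra.mul_mem S (Subalgebra.algebraMap_mem S _) (Subalgebra.pow_mem S hz' k)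
    have hu' : u K = ⟨ιA (∑ k ∈ Finset.range K, algebraMap ℚ_[p] (PadicAlgCl p)
        ((PowerSeries.coeff k G : ℤ_[p]) : ℚ_[p]) * z' ^ k), ⟨_, hmem, rfl⟩⟩ := by
      apply Subtype.ext
      simp only [hu, hιA_apply, map_sum, map_mul, map_pow]
      refine Finset.sum_congr rfl fun k _ => ?_
      rw [RingHom.comp_apply, PadicInt.algebraMap_apply, algebraMap_padicComplex_eq_comp, RingHom.comp_apply]
    rw [hu', hT_apply _ hmem, map_sum, map_sum]
    refine Finset.sum_congr rfl fun k _ => ?_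
    rw [map_mul, map_pow, AlgEquiv.commutes, map_mul, map_pow, hιA_apply, hιA_apply, RingHom.comp_apply,
      PadicInt.algebraMap_apply, algebraMap_padicComplex_eq_comp, RingHom.comp_apply]
  have hlim' : Tendsto (fun K => ∑ k ∈ Finset.range K, ((algebraMap ℚ_[p] ℂ_[p]).comp (algebraMap ℤ_[p] ℚ_[p]))
      (PowerSeries.coeff k G) * (algebraMap (PadicAlgCl p) ℂ_[p] (σ z')) ^ k) atTop
      (𝓝 (algebraMap (PadicAlgCl p) ℂ_[p] (σ a))) := by
    have h := hlimT
    rw [hTa] at h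
    refine h.congr fun K => ?_
    exact hTu K
  have hsum := summable_map_coeff_mul_pow ((algebraMap ℚ_[p] ℂ_[p]).comp (algebraMap ℤ_[p] ℚ_[p]))
    (norm_algebraMap_coeff_le_one G) hσz
  exact (hsum.hasSum_iff_tendsto_nat).mpr hlim'

end Transport

/-! ## §3 The descent -/

section Descent

/-- Primitive `p^n`-th roots of unity exist in `ℚ̄_p`. [folklore] -/
private theorem exists_isPrimitiveRoot_padicAlgCl_pow (n : ℕ) :
    ∃ ζ : PadicAlgCl p, IsPrimitiveRoot ζ (p ^ n) := by
  have hpos : 0 < p ^ n := pow_pos hp.out.pos n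
  obtain ⟨ζ, hζ⟩ := IsAlgClosed.exists_root (Polynomial.cyclotomic (p ^ n) (PadicAlgCl p))
    (Polynomial.degree_cyclotomic_pos (p ^ n) (PadicAlgCl p) hpos).ne'
  exact ⟨ζ, (Polynomial.isRoot_cyclotomic_iff_charZero hpos).mp hζ⟩

/-- An element of `ℚ̄_p` fixed by every `ℚ_p`-automorphism lies in `ℚ_p` (`ℚ̄_p/ℚ_p` is Galois: characteristic zero).
[folklore] -/
private theorem exists_eq_algebraMap_of_forall_aut_apply (c₀ : PadicAlgCl p)
    (h : ∀ σ : PadicAlgCl p ≃ₐ[ℚ_[p]] PadicAlgCl p, σ c₀ = c₀) :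
    ∃ c : ℚ_[p], algebraMap ℚ_[p] (PadicAlgCl p) c = c₀ :=
  (InfiniteGalois.mem_range_algebraMap_iff_fixed c₀).mpr h

/-- A non-zero element of `ℚ_p` is `p^{-m} · v · p^b` with `v ∈ ℤ_pˣ`: precisely, `p^m c = v p^b` in `ℤ_p` for some
`m b : ℕ`. [folklore] -/
private theorem exists_pow_mul_eq_units_mul_pow {c : ℚ_[p]} (hc : c ≠ 0) :
    ∃ (m b : ℕ) (v : ℤ_[p]ˣ), (p : ℚ_[p]) ^ m * c = ((v : ℤ_[p]) : ℚ_[p]) * (p : ℚ_[p]) ^ b := by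
  have hP : (1 : ℝ) < p := by exact_mod_cast hp.out.one_lt
  obtain ⟨m, hm⟩ := pow_unbounded_of_one_lt ‖c‖ hP
  have hnorm : ‖(p : ℚ_[p]) ^ m * c‖ ≤ 1 := by
    rw [norm_mul, norm_pow, Padic.norm_p, inv_pow, ← div_eq_inv_mul, div_le_one (by positivity)]
    exact hm.le
  set x : ℤ_[p] := ⟨(p : ℚ_[p]) ^ m * c, hnorm⟩ with hx
  have hx0 : x ≠ 0 := by
    intro h0
    have h1 : (p : ℚ_[p]) ^ m * c = 0 := by
      have := congrArg ((↑) : ℤ_[p] → ℚ_[p]) h0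
      simpa [hx] using this
    rcases mul_eq_zero.mp h1 with h | h
    · exact pow_ne_zero _ (Nat.cast_ne_zero.mpr hp.out.ne_zero) h
    · exact hc h
  refine ⟨m, x.valuation, PadicInt.unitCoeff hx0, ?_⟩
  have hspec := PadicInt.unitCoeff_spec hx0
  have h := congrArg ((↑) : ℤ_[p] → ℚ_[p]) hspec
  push_cast at h
  simpa [hx] using h

/-- **Descent of the constant and the `Λ`-relation.** Let `g, h ∈ Λ = ℤ_p⟦T⟧` with `g ≠ 0` and let `C ∈ ℂ_p`. Suppose
that for every EVEN `n > 0` and every Dirichlet character `ψ` modulo `p^{n+1}` of order `2pⁿ` with values in `ℂ_p`, the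
values of `g` and `h` at `ψ(γ) − 1` (`γ = 1 + p` the tree's `cyclotomicGenerator`, `p` odd) are proportional with ratio
`C`: whenever `Σ_k g_k (ψ(γ)−1)^k = a` and `Σ_k h_k (ψ(γ)−1)^k = b` then `a = C·b`. THEN `C = c` for a NON-ZERO
`c ∈ ℚ_p`, and `p^a · g = (v · p^b) · h` in `Λ` for some `a b : ℕ`, `v ∈ ℤ_pˣ` (module docstring, steps (1)–(5)).
[cite: Washington1997, Thm. 7.3 and §7.2] [cite: MazurTateTeitelbaum1986Invent, §I.12–I.14]
[cite: Kobayashi2003, §3 (3.4) (p. 7)] -/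
theorem IwasawaAlgebra.exists_pow_smul_eq_of_values_proportional (hp2 : p ≠ 2) {g h : IwasawaAlgebra p}
    (hg0 : g ≠ 0) (C : ℂ_[p])
    (H : ∀ n : ℕ, Even n → 0 < n → ∀ ψ : DirichletCharacter ℂ_[p] (p ^ (n + 1)), orderOf ψ = 2 * p ^ n →
      ∀ a b : ℂ_[p],
        HasSum (fun k ↦ ((algebraMap ℚ_[p] ℂ_[p]).comp (algebraMap ℤ_[p] ℚ_[p])) (PowerSeries.coeff k g) *
          (ψ (cyclotomicGenerator p : ZMod (p ^ (n + 1))) - 1) ^ k) a →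
        HasSum (fun k ↦ ((algebraMap ℚ_[p] ℂ_[p]).comp (algebraMap ℤ_[p] ℚ_[p])) (PowerSeries.coeff k h) *
          (ψ (cyclotomicGenerator p : ZMod (p ^ (n + 1))) - 1) ^ k) b →
        a = C * b) :
    ∃ c : ℚ_[p], c ≠ 0 ∧ algebraMap ℚ_[p] ℂ_[p] c = C ∧
      ∃ (a b : ℕ) (v : ℤ_[p]ˣ), ((p : ℤ_[p]) ^ a) • g = ((v : ℤ_[p]) * (p : ℤ_[p]) ^ b) • h := by
  have hP : p.Prime := hp.out
  set ι : ℤ_[p] →+* ℂ_[p] := (algebraMap ℚ_[p] ℂ_[p]).comp (algebraMap ℤ_[p] ℚ_[p]) with hι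
  set ιK : PadicAlgCl p →+* ℂ_[p] := algebraMap (PadicAlgCl p) ℂ_[p] with hιK
  -- values as `tsum`s; the law at a primitive `p^n`-th root of unity of `ℂ_p`, `n` even `> 0`
  have hsumm : ∀ (G : IwasawaAlgebra p) {z : ℂ_[p]}, ‖z‖ < 1 →
      Summable fun k ↦ ι (PowerSeries.coeff k G) * z ^ k := fun G z hz =>
    summable_map_coeff_mul_pow ι (norm_algebraMap_coeff_le_one G) hz
  have hlaw : ∀ {n : ℕ}, Even n → 0 < n → ∀ {ζ : ℂ_[p]}, IsPrimitiveRoot ζ (p ^ n) → ∀ a b : ℂ_[p],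
      HasSum (fun k ↦ ι (PowerSeries.coeff k g) * (ζ - 1) ^ k) a →
      HasSum (fun k ↦ ι (PowerSeries.coeff k h) * (ζ - 1) ^ k) b → a = C * b := by
    intro n hn hn0 ζ hζ a b ha hb
    obtain ⟨ψ, hψ, hψγ⟩ := Kobayashi2003.exists_dirichletCharacter_orderOf_two_mul_prime_pow hp2 hn0 hζ
    refine H n hn hn0 ψ hψ a b ?_ ?_
    · rw [hψγ]; exact ha
    · rw [hψγ]; exact hb
  -- (1) a level `n₁ = 2k₁+2` and a primitive root `ζ₁ ∈ ℚ̄_p` with `g(ζ₁ − 1) ≠ 0`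
  choose ζ' hζ' using fun k : ℕ ↦ exists_isPrimitiveRoot_padicAlgCl_pow (p := p) (2 * k + 2)
  have hζ : ∀ k, IsPrimitiveRoot (ιK (ζ' k)) (p ^ (2 * k + 2)) := fun k =>
    (hζ' k).map_of_injective (algebraMap (PadicAlgCl p) ℂ_[p]).injective
  have hz : ∀ k, ‖ιK (ζ' k) - 1‖ < 1 := fun k =>
    norm_sub_one_lt_one_of_pow_prime_pow_eq_one (hζ k).pow_eq_one
  have hex : ∃ k, (∑' j, ι (PowerSeries.coeff j g) * (ιK (ζ' k) - 1) ^ j) ≠ 0 := by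
    by_contra hall
    push Not at hall
    have hg' : iwasawaToPowerSeries p g ≠ 0 := fun h0 ↦
      hg0 (iwasawaToPowerSeries_injective p (by rw [h0, map_zero]))
    have hfin := MemIwasawaRat.finite_setOf_hasSum_zero (memIwasawaRat_iwasawaToPowerSeries p g) hg'
    have hcoe : ∀ k : ℕ, algebraMap ℚ_[p] ℂ_[p] (PowerSeries.coeff k (iwasawaToPowerSeries p g)) =
        ι (PowerSeries.coeff k g) := by
      intro k
      simp only [hι, RingHom.comp_apply, iwasawaToPowerSeries, PowerSeries.coeff_map]
    have hmem : ∀ k, ιK (ζ' k) - 1 ∈ {z : ℂ_[p] | ‖z‖ < 1 ∧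
        HasSum (fun j ↦ algebraMap ℚ_[p] ℂ_[p] (PowerSeries.coeff j (iwasawaToPowerSeries p g)) * z ^ j) 0} := by
      intro k
      refine ⟨hz k, ?_⟩
      simp_rw [hcoe]
      rw [← hall k]
      exact (hsumm g (hz k)).hasSum
    have hinjζ : Function.Injective fun k ↦ ιK (ζ' k) - 1 := by
      intro a b hab
      have hζab : ιK (ζ' a) = ιK (ζ' b) := sub_left_injective hab
      have ho : p ^ (2 * a + 2) = p ^ (2 * b + 2) := by
        rw [(hζ a).eq_orderOf, (hζ b).eq_orderOf, hζab]
      have := Nat.pow_right_injective hP.two_le ho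
      omega
    exact hfin.not_infinite
      ((Set.infinite_range_of_injective hinjζ).mono (Set.range_subset_iff.mpr hmem))
  obtain ⟨k₁, hk₁⟩ := hex
  -- (2) algebraicity at `ζ₁`: the subalgebra `ℚ_p[ζ₁]`
  set ζ₁ : PadicAlgCl p := ζ' k₁ with hζ₁
  have hint : IsIntegral ℚ_[p] ζ₁ := ((hζ' k₁).isIntegral (pow_pos hP.pos _)).tower_top
  set S : Subalgebra ℚ_[p] (PadicAlgCl p) := Algebra.adjoin ℚ_[p] {ζ₁} with hS
  haveI : FiniteDimensional ℚ_[p] (Subalgebra.toSubmodule S) :=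
    Module.Finite.iff_fg.mpr hint.fg_adjoin_singleton
  have hζ₁S : ζ₁ ∈ S := Algebra.self_mem_adjoin_singleton ℚ_[p] ζ₁
  have hz₁S : ζ₁ - 1 ∈ S := Subalgebra.sub_mem S hζ₁S (Subalgebra.one_mem S)
  have hz₁ : ‖ιK (ζ₁ - 1)‖ < 1 := by rw [map_sub, map_one]; exact hz k₁
  obtain ⟨ag, hagS, hag⟩ := exists_mem_hasSum_of_mem_subalgebra S g hz₁S hz₁
  obtain ⟨ah, hahS, hah⟩ := exists_mem_hasSum_of_mem_subalgebra S h hz₁S hz₁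
  have hag' : HasSum (fun k ↦ ι (PowerSeries.coeff k g) * (ιK ζ₁ - 1) ^ k) (ιK ag) := by
    have := hag; rwa [map_sub, map_one] at this
  have hah' : HasSum (fun k ↦ ι (PowerSeries.coeff k h) * (ιK ζ₁ - 1) ^ k) (ιK ah) := by
    have := hah; rwa [map_sub, map_one] at this
  have hlaw₁ : ιK ag = C * ιK ah := hlaw ⟨k₁ + 1, by ring⟩ (by omega) (hζ k₁) _ _ hag' hah'
  have hag0 : ιK ag ≠ 0 := by rw [← hag'.tsum_eq]; exact hk₁
  have hC0 : C ≠ 0 := by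
    intro hC; rw [hC, zero_mul] at hlaw₁; exact hag0 hlaw₁
  have hah0 : ah ≠ 0 := by
    intro h0; rw [h0, map_zero, mul_zero] at hlaw₁; exact hag0 hlaw₁
  have hCeq : C = ιK (ag / ah) := by
    rw [map_div₀, hlaw₁, mul_div_assoc, div_self ((map_ne_zero ιK).mpr hah0), mul_one]
  -- (3) Galois transport: `σ (ag/ah) = ag/ah` for every `σ ∈ Aut(ℚ̄_p/ℚ_p)`
  have hfix : ∀ σ : PadicAlgCl p ≃ₐ[ℚ_[p]] PadicAlgCl p, σ (ag / ah) = ag / ah := by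
    intro σ
    have hσζ : IsPrimitiveRoot (ιK (σ ζ₁)) (p ^ (2 * k₁ + 2)) :=
      ((hζ' k₁).map_of_injective σ.injective).map_of_injective (algebraMap (PadicAlgCl p) ℂ_[p]).injective
    have hσz : ‖ιK (σ (ζ₁ - 1))‖ < 1 := by
      rw [map_sub, map_one, map_sub, map_one]
      exact norm_sub_one_lt_one_of_pow_prime_pow_eq_one hσζ.pow_eq_one
    have hg₂ := hasSum_map_of_hasSum_of_mem_subalgebra S g σ hz₁S hagS hag hσz
    have hh₂ := hasSum_map_of_hasSum_of_mem_subalgebra S h σ hz₁S hahS hah hσz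
    rw [map_sub, map_one, map_sub, map_one] at hg₂ hh₂
    have hlaw₂ : ιK (σ ag) = C * ιK (σ ah) := hlaw ⟨k₁ + 1, by ring⟩ (by omega) hσζ _ _ hg₂ hh₂
    have hσah0 : σ ah ≠ 0 := (map_ne_zero σ).mpr hah0
    have hCeq' : C = ιK (σ (ag / ah)) := by
      rw [map_div₀, map_div₀, hlaw₂, mul_div_assoc, div_self ((map_ne_zero ιK).mpr hσah0), mul_one]
    exact (algebraMap (PadicAlgCl p) ℂ_[p]).injective (hCeq'.symm.trans hCeq)
  -- (4) `C = c ∈ ℚ_p`, `c ≠ 0`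
  obtain ⟨c, hc⟩ := exists_eq_algebraMap_of_forall_aut_apply (ag / ah) hfix
  have hcC : algebraMap ℚ_[p] ℂ_[p] c = C := by
    rw [algebraMap_padicComplex_eq_comp, RingHom.comp_apply, hc, ← hCeq]
  have hc0 : c ≠ 0 := by
    intro h0; apply hC0; rw [← hcC, h0, map_zero]
  refine ⟨c, hc0, hcC, ?_⟩
  -- (5) `p^m c = v p^b ∈ ℤ_p`; `D := p^m g − (v p^b) h` vanishes at every `ζ − 1`, hence `D = 0`
  obtain ⟨m, b, v, hmb⟩ := exists_pow_mul_eq_units_mul_pow hc0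
  refine ⟨m, b, v, ?_⟩
  set D : IwasawaAlgebra p := ((p : ℤ_[p]) ^ m) • g - ((v : ℤ_[p]) * (p : ℤ_[p]) ^ b) • h with hDdef
  suffices hD0 : D = 0 from (sub_eq_zero.mp hD0)
  by_contra hD
  have hD' : iwasawaToPowerSeries p D ≠ 0 := fun h0 ↦
    hD (iwasawaToPowerSeries_injective p (by rw [h0, map_zero]))
  have hfin := MemIwasawaRat.finite_setOf_hasSum_zero (memIwasawaRat_iwasawaToPowerSeries p D) hD'
  have hcoeD : ∀ k : ℕ, algebraMap ℚ_[p] ℂ_[p] (PowerSeries.coeff k (iwasawaToPowerSeries p D)) =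
      ι (PowerSeries.coeff k D) := by
    intro k
    simp only [hι, RingHom.comp_apply, iwasawaToPowerSeries, PowerSeries.coeff_map]
  have hcoeffD : ∀ k, PowerSeries.coeff k D =
      (p : ℤ_[p]) ^ m * PowerSeries.coeff k g - ((v : ℤ_[p]) * (p : ℤ_[p]) ^ b) * PowerSeries.coeff k h := by
    intro k
    rw [hDdef, map_sub, PowerSeries.coeff_smul, PowerSeries.coeff_smul, smul_eq_mul, smul_eq_mul]
  have hιpm : ι ((p : ℤ_[p]) ^ m) = algebraMap ℚ_[p] ℂ_[p] ((p : ℚ_[p]) ^ m) := by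
    simp only [hι, map_pow, map_natCast]
  have hιv : ι ((v : ℤ_[p]) * (p : ℤ_[p]) ^ b) = algebraMap ℚ_[p] ℂ_[p] ((p : ℚ_[p]) ^ m * c) := by
    rw [hmb, hι, RingHom.comp_apply, map_mul, map_pow, map_natCast, PadicInt.algebraMap_apply]
  have hmemD : ∀ k, ιK (ζ' k) - 1 ∈ {z : ℂ_[p] | ‖z‖ < 1 ∧
      HasSum (fun j ↦ algebraMap ℚ_[p] ℂ_[p] (PowerSeries.coeff j (iwasawaToPowerSeries p D)) * z ^ j) 0} := by
    intro k
    have hzk : ‖ιK (ζ' k) - 1‖ < 1 := norm_sub_one_lt_one_of_pow_prime_pow_eq_one (hζ k).pow_eq_one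
    refine ⟨hzk, ?_⟩
    have e₁ := (hsumm g hzk).hasSum
    have e₂ := (hsumm h hzk).hasSum
    have hab := hlaw ⟨k + 1, by ring⟩ (by omega) (hζ k) _ _ e₁ e₂
    have hsub := (e₁.mul_left (ι ((p : ℤ_[p]) ^ m))).sub (e₂.mul_left (ι ((v : ℤ_[p]) * (p : ℤ_[p]) ^ b)))
    have hrhs : ι ((p : ℤ_[p]) ^ m) * (∑' j, ι (PowerSeries.coeff j g) * (ιK (ζ' k) - 1) ^ j) -
        ι ((v : ℤ_[p]) * (p : ℤ_[p]) ^ b) * (∑' j, ι (PowerSeries.coeff j h) * (ιK (ζ' k) - 1) ^ j) = 0 := by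
      rw [hab, hιpm, hιv, map_mul, hcC]
      ring
    rw [hrhs] at hsub
    have hfun : (fun j ↦ algebraMap ℚ_[p] ℂ_[p] (PowerSeries.coeff j (iwasawaToPowerSeries p D)) *
        (ιK (ζ' k) - 1) ^ j) = fun j ↦
        ι ((p : ℤ_[p]) ^ m) * (ι (PowerSeries.coeff j g) * (ιK (ζ' k) - 1) ^ j) -
          ι ((v : ℤ_[p]) * (p : ℤ_[p]) ^ b) * (ι (PowerSeries.coeff j h) * (ιK (ζ' k) - 1) ^ j) := by
      funext j
      rw [hcoeD, hcoeffD, map_sub, map_mul, map_mul]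
      ring
    rw [hfun]
    exact hsub
  have hinjξ : Function.Injective fun k ↦ ιK (ζ' k) - 1 := by
    intro a b' hab
    have hξab : ιK (ζ' a) = ιK (ζ' b') := sub_left_injective hab
    have ho : p ^ (2 * a + 2) = p ^ (2 * b' + 2) := by
      rw [(hζ a).eq_orderOf, (hζ b').eq_orderOf, hξab]
    have := Nat.pow_right_injective hP.two_le ho
    omega
  exact hfin.not_infinite
    ((Set.infinite_range_of_injective hinjξ).mono (Set.range_subset_iff.mpr hmemD))

end Descent

end Literature.NumberTheory.EllipticCurves

end
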